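import Mathlib
import HarnessLib
import Literature.NumberTheory.DiophantineGeometry.BelyiWitnessExtremal

/-!
# Crux `CompactBalanceTransfer` (stmt-ABC-1725) — the Mason–Stothers toll on balancing correspondences

Negative-side structure lemmas written by the line lead (`prover-line-stmt-ABC-1725-c5-0`, line `birth`,
2026-08-17) for the crux `CompactBalanceTransfer := H → ABC` of route CongruentialReceptacle, where
`H := ∀ κ > 0, ∀ ε > 0, ∃ C, ∀ abc-triples, κc ≤ a → κc ≤ b → c < C · rad(abc)^(1+ε)` (abc on every compactly
balanced cell).  The open stub `stub_balancedToFreySzpiro : H → F` of the registered skeleton asks, in substance,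
that `H` be brought to bear on DEEP triples (`min(a,b)/c → 0`), on which it says nothing directly; the one uniform
device for doing so is a bounded-degree `ℚ`-correspondence of `ℙ¹ ∖ {0,1,∞}`: a polynomial identity
`p(x) + (q − p)(x) = q(x)`, `p, q ∈ ℚ[X]` coprime, `d = max (deg p) (deg q)`, evaluated at `x = a/c` and cleared of
denominators, which turns the abc-triple `(a, b, c)` into the integer triple
`(c^d p(a/c), c^d (q−p)(a/c), c^d q(a/c))` of height `d·log c + O(1)`.  Its radical is controlled exactly by the
fibre of `β = p/q` over `{0, 1, ∞}`: the linear factors `a` (zero `x = 0`), `b = c − a` (zero `x = 1`) and `c`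
(the point `∞`) are CHEAP (their radical divides `rad(abc)`), every other zero `r ∈ ℚ̄` of `p·q·(p−q)` contributes
an EXPENSIVE factor `a − r c` about whose radical nothing better than `rad(n) ≤ |n| ≤ K·c` is known.  Writing
`D := #{zeros of p·q·(p−q) in ℚ̄} ∖ {0, 1}` for the expensive count, `H` applied to the image yields for the source
only `rad(abc) ≫ c^θ` with the TRANSFERRED EXPONENT `θ = d/(1+ε′) − D`, which contradicts an abc-counterexample
family `rad(abc) ≤ c^{1/(1+ε₀)}` iff `θ > 1/(1+ε₀)`.

This file kernel-checks the obstruction known on the crux record as Lemma NA / O1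
(`Cruxes/CompactBalanceTransfer/Obstructions-r1-k2.md` §2, `Disproof.lean` §3: "informal, not formalised here";
confirmed numerically by the slope-LP searches of the disprover and lead c1 up to degree 5), for ALL degrees:

* `correspondence_toll_count` : `d ≤ D + 1` always (Mason–Stothers, via the tree's
  `succ_max_natDegree_le_card_roots`: `p·q·(p−q)` has at least `d + 1` distinct zeros);
* `cusp_preserving_of_tight` : `D + 1 ≤ d` (the only case in which the toll bites, `toll_bites`) forces
  `p·q·(p−q)` to vanish at BOTH `0` and `1` — the correspondence is cusp-preserving, so the image of a deep point
  is deep (`beta_zero_mem_cusps_iff`: `β(0) ∈ {0, 1, ∞}`), never compactly balanced;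
* `correspondence_toll_of_balanced_at_zero` : conversely a balanced image of the deep end `x → 0`
  (`(p·q·(p−q))(0) ≠ 0`) costs `D ≥ d` — one full degree of junk, "a toll of one full `log c`";
* `toll_vacuous` / `toll_bites` : the exponent bookkeeping — `D ≥ d ⇒ θ = d/(1+ε′) − D < 1/(1+ε₀)` for every
  `ε′, ε₀ > 0` (indeed `θ < 0`: the transferred bound is trivial), while `D + 1 ≤ d ⇒ ∃ ε′ > 0, θ > 1/(1+ε₀)`;
* `correspondence_toll` : the headline — for coprime `p, q` of positive degree with `(p·q·(p−q))(0) ≠ 0` the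
  transferred exponent is below EVERY counterexample exponent; `correspondence_toll_rat` : the same for
  `p, q ∈ ℚ[X]` with zeros counted in `ℂ` (so `D` = total degree of the expensive `ℚ`-irreducible factors).

Reading for the crux: no bounded-degree algebraic move makes `H` (or any abc-statement on the balanced cell, with
any constants) say anything non-trivial about a deep triple; depth is preserved by every identity that transfers
quality (`{0,1} ⊂` fibre), which is why the squaring/power-map descents in the tree
(`QuarterWindowGivesCrux`, `Negative/DepthCellDissolution`) move depth by bounded factors only and why stub 1 of line
`birth` has no algebraic mechanism.  This is a floor for a METHOD (the trivial bound on expensive radicals), in the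
style of `Theorems/TowerFourSubLiouville/Negative/PolynomialEnemyFloor.lean`; it refutes nothing and is implied by
nothing conjectural.  No `def`s (statements inlined); unconditional; axioms standard.
-/

-- `Summit.<Summit>.<Problem>`: for the single-conjunct summit `ABC` the duplicate `ABC.ABC` is mandated.
set_option linter.dupNamespace false

namespace Summit.ABC.ABC.Theorems.CompactBalanceTransfer.Negative

open Polynomial
open Literature.NumberTheory.DiophantineGeometry

section Count

variable {k : Type*} [Field k] [IsAlgClosed k] [CharZero k] [DecidableEq k]

/-- For coprime `p, q` with `max (deg p) (deg q) ≥ 1` the product `p · q · (p − q)` is non-zero (it has at least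
`d + 1 ≥ 2` distinct zeros by Mason–Stothers). [folklore] -/
theorem mul_mul_sub_ne_zero_of_isCoprime {p q : k[X]} (hcop : IsCoprime p q) {d : ℕ}
    (hmax : max p.natDegree q.natDegree = d) (hd : 0 < d) : p * q * (p - q) ≠ 0 := by
  intro h
  have hN := succ_max_natDegree_le_card_roots hcop hmax hd
  rw [h, roots_zero, Multiset.toFinset_zero, Finset.card_empty] at hN
  omega

/-- **The toll count (Lemma NA, counting form).** For coprime `p, q ∈ k[X]` (`k` algebraically closed of
characteristic `0`) with `max (deg p) (deg q) = d ≥ 1`, the number `D` of zeros of `p · q · (p − q)` other than the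
two cusps `0, 1` satisfies `d ≤ D + 1`: a degree-`d` correspondence of `ℙ¹ ∖ {0,1,∞}` carries at least `d − 1`
expensive points in its fibre over `{0, 1, ∞}`.  (Mason–Stothers: at least `d + 1` distinct zeros in all.)
[folklore] -/
theorem correspondence_toll_count {p q : k[X]} (hcop : IsCoprime p q) {d : ℕ}
    (hmax : max p.natDegree q.natDegree = d) (hd : 0 < d) :
    d ≤ ((p * q * (p - q)).roots.toFinset \ {0, 1}).card + 1 := by
  have hN := succ_max_natDegree_le_card_roots hcop hmax hd
  have hsplit := Finset.card_sdiff_add_card_inter (p * q * (p - q)).roots.toFinset {0, 1}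
  have hle : ((p * q * (p - q)).roots.toFinset ∩ {0, 1}).card ≤ 2 :=
    (Finset.card_le_card Finset.inter_subset_right).trans (Finset.card_pair (zero_ne_one' k)).le
  omega

/-- **Tight correspondences are cusp-preserving.** If the expensive count is as small as Mason–Stothers allows,
`D + 1 ≤ d` (the only case in which the transferred exponent can beat a counterexample exponent, `toll_bites`),
then `p · q · (p − q)` vanishes at `0` AND at `1`: both finite cusps lie in the fibre of `p/q` over `{0, 1, ∞}`,
so the image of a deep point is again deep. [folklore] -/
theorem cusp_preserving_of_tight {p q : k[X]} (hcop : IsCoprime p q) {d : ℕ}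
    (hmax : max p.natDegree q.natDegree = d) (hd : 0 < d)
    (htight : ((p * q * (p - q)).roots.toFinset \ {0, 1}).card + 1 ≤ d) :
    (p * q * (p - q)).eval 0 = 0 ∧ (p * q * (p - q)).eval 1 = 0 := by
  have hf0 : p * q * (p - q) ≠ 0 := mul_mul_sub_ne_zero_of_isCoprime hcop hmax hd
  have hN := succ_max_natDegree_le_card_roots hcop hmax hd
  have hsplit := Finset.card_sdiff_add_card_inter (p * q * (p - q)).roots.toFinset {0, 1}
  have hsub : (p * q * (p - q)).roots.toFinset ∩ {0, 1} ⊆ {0, 1} := Finset.inter_subset_right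
  have h2 : ({0, 1} : Finset k).card = 2 := Finset.card_pair (zero_ne_one' k)
  have heq : (p * q * (p - q)).roots.toFinset ∩ {0, 1} = {0, 1} :=
    Finset.eq_of_subset_of_card_le hsub (by rw [h2]; omega)
  have hmem : ∀ x ∈ ({0, 1} : Finset k), (p * q * (p - q)).eval x = 0 := by
    intro x hx
    rw [← heq] at hx
    have hxr := (Finset.mem_inter.mp hx).1
    rw [Multiset.mem_toFinset, mem_roots hf0] at hxr
    exact hxr
  exact ⟨hmem 0 (by simp), hmem 1 (by simp)⟩

/-- **A balanced image of the deep end `x → 0` costs one full degree.** If `p · q · (p − q)` does not vanish at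
`0` (i.e. `β = p/q` maps the cusp `0` into `ℙ¹ ∖ {0,1,∞}`, so that the images of triples with `a/c → 0` stay
compactly balanced), then the expensive count is at least `d`. [folklore] -/
theorem correspondence_toll_of_balanced_at_zero {p q : k[X]} (hcop : IsCoprime p q) {d : ℕ}
    (hmax : max p.natDegree q.natDegree = d) (hd : 0 < d)
    (h0 : (p * q * (p - q)).eval 0 ≠ 0) :
    d ≤ ((p * q * (p - q)).roots.toFinset \ {0, 1}).card := by
  have hf0 : p * q * (p - q) ≠ 0 := mul_mul_sub_ne_zero_of_isCoprime hcop hmax hd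
  have hN := succ_max_natDegree_le_card_roots hcop hmax hd
  have hsplit := Finset.card_sdiff_add_card_inter (p * q * (p - q)).roots.toFinset {0, 1}
  have hsub : (p * q * (p - q)).roots.toFinset ∩ {0, 1} ⊆ {1} := by
    intro x hx
    obtain ⟨hxr, hx01⟩ := Finset.mem_inter.mp hx
    rw [Multiset.mem_toFinset, mem_roots hf0] at hxr
    rcases Finset.mem_insert.mp hx01 with rfl | hx1
    · exact absurd hxr h0
    · exact hx1
  have hle : ((p * q * (p - q)).roots.toFinset ∩ {0, 1}).card ≤ 1 :=
    (Finset.card_le_card hsub).trans (Finset.card_singleton (1 : k)).le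
  omega

/-- The same toll for a balanced image of the other deep end `x → 1` (`b/c → 0`). [folklore] -/
theorem correspondence_toll_of_balanced_at_one {p q : k[X]} (hcop : IsCoprime p q) {d : ℕ}
    (hmax : max p.natDegree q.natDegree = d) (hd : 0 < d)
    (h1 : (p * q * (p - q)).eval 1 ≠ 0) :
    d ≤ ((p * q * (p - q)).roots.toFinset \ {0, 1}).card := by
  have hf0 : p * q * (p - q) ≠ 0 := mul_mul_sub_ne_zero_of_isCoprime hcop hmax hd
  have hN := succ_max_natDegree_le_card_roots hcop hmax hd
  have hsplit := Finset.card_sdiff_add_card_inter (p * q * (p - q)).roots.toFinset {0, 1}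
  have hsub : (p * q * (p - q)).roots.toFinset ∩ {0, 1} ⊆ {0} := by
    intro x hx
    obtain ⟨hxr, hx01⟩ := Finset.mem_inter.mp hx
    rw [Multiset.mem_toFinset, mem_roots hf0] at hxr
    rcases Finset.mem_insert.mp hx01 with hx0 | hx1
    · exact Finset.mem_singleton.mpr hx0
    · rw [Finset.mem_singleton] at hx1
      subst hx1
      exact absurd hxr h1
  have hle : ((p * q * (p - q)).roots.toFinset ∩ {0, 1}).card ≤ 1 :=
    (Finset.card_le_card hsub).trans (Finset.card_singleton (0 : k)).le
  omega

/-- A correspondence balanced at BOTH deep ends pays `D ≥ d + 1`. [folklore] -/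
theorem correspondence_toll_of_balanced {p q : k[X]} (hcop : IsCoprime p q) {d : ℕ}
    (hmax : max p.natDegree q.natDegree = d) (hd : 0 < d)
    (h0 : (p * q * (p - q)).eval 0 ≠ 0) (h1 : (p * q * (p - q)).eval 1 ≠ 0) :
    d + 1 ≤ ((p * q * (p - q)).roots.toFinset \ {0, 1}).card := by
  have hf0 : p * q * (p - q) ≠ 0 := mul_mul_sub_ne_zero_of_isCoprime hcop hmax hd
  have hN := succ_max_natDegree_le_card_roots hcop hmax hd
  have hsplit := Finset.card_sdiff_add_card_inter (p * q * (p - q)).roots.toFinset {0, 1}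
  have hsub : (p * q * (p - q)).roots.toFinset ∩ {0, 1} ⊆ ∅ := by
    intro x hx
    obtain ⟨hxr, hx01⟩ := Finset.mem_inter.mp hx
    rw [Multiset.mem_toFinset, mem_roots hf0] at hxr
    rcases Finset.mem_insert.mp hx01 with hx0 | hx1
    · subst hx0; exact absurd hxr h0
    · rw [Finset.mem_singleton] at hx1
      subst hx1
      exact absurd hxr h1
  have hle : ((p * q * (p - q)).roots.toFinset ∩ {0, 1}).card = 0 :=
    Finset.card_eq_zero.mpr (Finset.subset_empty.mp hsub)
  omega

end Count

section Cusps

variable {R : Type*} [CommRing R] [IsDomain R]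

/-- Dictionary: `p · q · (p − q)` vanishes at `0` iff `β = p/q` sends the cusp `0` to a cusp — `β(0) = 0`
(`p(0) = 0`), `β(0) = ∞` (`q(0) = 0`) or `β(0) = 1` (`p(0) = q(0)`); in each case the image of a triple with
`a/c → 0` has `min(a′,b′)/c′ → 0`, i.e. is deep again. [folklore] -/
theorem beta_zero_mem_cusps_iff (p q : R[X]) :
    (p * q * (p - q)).eval 0 = 0 ↔ p.eval 0 = 0 ∨ q.eval 0 = 0 ∨ p.eval 0 = q.eval 0 := by
  simp only [eval_mul, eval_sub, mul_eq_zero, sub_eq_zero, or_assoc]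

end Cusps

section Bookkeeping

/-- **Toll vacuous.** With `D ≥ d` expensive points the transferred exponent `θ = d/(1+ε′) − D` is below every
counterexample exponent `1/(1+ε₀)` (indeed `θ < 0`): `H` on the balanced images says nothing about the deep
sources. [folklore] -/
theorem toll_vacuous {d D : ℕ} (hD : d ≤ D) {ε' ε₀ : ℝ} (hε' : 0 < ε') (hε₀ : 0 < ε₀) :
    (d : ℝ) / (1 + ε') - D < 1 / (1 + ε₀) := by
  have h1 : (d : ℝ) / (1 + ε') ≤ d := div_le_self (Nat.cast_nonneg d) (by linarith)
  have h2 : (d : ℝ) ≤ D := by exact_mod_cast hD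
  have h3 : (0 : ℝ) < 1 / (1 + ε₀) := by positivity
  linarith

/-- **Toll bites only in the tight case.** With `D + 1 ≤ d` (cusp-preserving correspondences,
`cusp_preserving_of_tight`) a small enough `ε′` makes the transferred exponent exceed the counterexample exponent:
such identities DO transfer abc-counterexamples to abc-counterexamples — but deep ones to deep ones. [folklore] -/
theorem toll_bites {d D : ℕ} (hD : D + 1 ≤ d) {ε₀ : ℝ} (hε₀ : 0 < ε₀) :
    ∃ ε' : ℝ, 0 < ε' ∧ 1 / (1 + ε₀) < (d : ℝ) / (1 + ε') - D := by
  set t : ℝ := ε₀ / (1 + ε₀) with ht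
  have ht0 : 0 < t := by positivity
  have ht1 : 1 / (1 + ε₀) = 1 - t := by
    rw [ht]; field_simp; ring
  have hD1 : (0 : ℝ) < (D : ℝ) + 1 := by positivity
  refine ⟨t / (2 * ((D : ℝ) + 1)), by positivity, ?_⟩
  set ε' : ℝ := t / (2 * ((D : ℝ) + 1)) with hε'
  have hε'0 : 0 < ε' := by positivity
  have hdD : (D : ℝ) + 1 ≤ d := by exact_mod_cast hD
  -- `1/(1+ε′) ≥ 1 − ε′`, so `d/(1+ε′) ≥ (D+1)(1−ε′) = D + 1 − t/2`
  have hinv : 1 - ε' ≤ 1 / (1 + ε') := by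
    rw [le_div_iff₀ (by linarith)]; nlinarith
  have hkey : ((D : ℝ) + 1) * (1 - ε') ≤ (d : ℝ) / (1 + ε') :=
    calc ((D : ℝ) + 1) * (1 - ε') ≤ ((D : ℝ) + 1) * (1 / (1 + ε')) :=
          mul_le_mul_of_nonneg_left hinv hD1.le
      _ = ((D : ℝ) + 1) / (1 + ε') := by ring
      _ ≤ (d : ℝ) / (1 + ε') := div_le_div_of_nonneg_right hdD (by linarith)
  have hprod : ((D : ℝ) + 1) * ε' = t / 2 := by
    rw [hε']; field_simp
  rw [ht1]
  nlinarith

end Bookkeeping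

section Headline

variable {k : Type*} [Field k] [IsAlgClosed k] [CharZero k] [DecidableEq k]

/-- **Lemma NA (the correspondence toll), headline form.** For a coprime pair `p, q ∈ k[X]` of positive degree
`d` whose correspondence keeps the deep end `x → 0` away from the cusps (`(p·q·(p−q))(0) ≠ 0`), and for every
choice of exponents `ε′, ε₀ > 0`, the exponent transferred from `H` on the images, `d/(1+ε′) − D`, is smaller than
the counterexample exponent `1/(1+ε₀)`: balancing a deep abc-triple by a bounded-degree identity is tolled into
vacuity. [folklore] -/
theorem correspondence_toll {p q : k[X]} (hcop : IsCoprime p q) {d : ℕ}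
    (hmax : max p.natDegree q.natDegree = d) (hd : 0 < d)
    (h0 : (p * q * (p - q)).eval 0 ≠ 0) {ε' ε₀ : ℝ} (hε' : 0 < ε') (hε₀ : 0 < ε₀) :
    (d : ℝ) / (1 + ε') - (((p * q * (p - q)).roots.toFinset \ {0, 1}).card : ℕ) < 1 / (1 + ε₀) :=
  toll_vacuous (correspondence_toll_of_balanced_at_zero hcop hmax hd h0) hε' hε₀

/-- **Lemma NA over `ℚ`.** For coprime `p, q ∈ ℚ[X]` with `max (deg p) (deg q) = d ≥ 1` and `(p·q·(p−q))(0) ≠ 0`,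
the number of complex zeros of `p·q·(p−q)` other than `0, 1` — the total degree of the expensive `ℚ`-irreducible
factors of the transferred triple — is at least `d`. [folklore] -/
theorem correspondence_toll_rat {p q : ℚ[X]} (hcop : IsCoprime p q) {d : ℕ}
    (hmax : max p.natDegree q.natDegree = d) (hd : 0 < d)
    (h0 : (p * q * (p - q)).eval 0 ≠ 0) :
    d ≤ (((p * q * (p - q)).map (algebraMap ℚ ℂ)).roots.toFinset \ {0, 1}).card := by
  set f := algebraMap ℚ ℂ with hf
  have hcop' : IsCoprime (p.map f) (q.map f) := (isCoprime_map f).mpr hcop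
  have hmax' : max (p.map f).natDegree (q.map f).natDegree = d := by
    rw [natDegree_map, natDegree_map, hmax]
  have hmapf : (p * q * (p - q)).map f = p.map f * q.map f * (p.map f - q.map f) := by
    simp only [Polynomial.map_mul, Polynomial.map_sub]
  have h0' : (p.map f * q.map f * (p.map f - q.map f)).eval 0 ≠ 0 := by
    rw [← hmapf, eval_zero_map]
    exact (map_ne_zero_iff f (algebraMap ℚ ℂ).injective).mpr h0
  rw [hmapf]
  exact correspondence_toll_of_balanced_at_zero hcop' hmax' hd h0'

end Headline

end Summit.ABC.ABC.Theorems.CompactBalanceTransfer.Negative
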